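import Mathlib
import HarnessLib
import Summits.HubbardSuperconductivity.HubbardSuperconductivity.Theorems.KLProgrammeKLRegimeTwoVolumeTowerStepCovTelescope
import Summits.HubbardSuperconductivity.HubbardSuperconductivity.Theorems.KLProgrammeKLRegimeSectorSliceFamilyDefectRows

/-!
# K3 VL child `KLRegimeVolumeLimitV17F2` (stmt-HubbardSuperconductivity-20440), located item #23 «W2-HALF-VL», part 3: the SECTIONAL dictionary for the
# telescope pieces — fixed-time weighted character-sum bounds ⇒ sectional rows of the covariance piece and of the family piece (ε-free inputs of
# `scaleCovSecData_klStepCov_of_frame_telescope`)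

Cell `gate-hubbard-kl`, seat p3 (g13), lead of #23.  The sectional telescope `scaleCovSecData_klStepCov_of_frame_telescope` (`…TowerStepCovTelescope`) reads,
per frame step, the `(1 + Λ_w·tnorm)`-weighted SECTIONAL rows (fixed out-leg `X`, time slice `t`, label `ℓ`; sum over the sites `y`) of the covariance piece
`Cov(K,K′) = S(F̃_k[K])ᵀ·(C^{K′} − C^{K})·S(F̃_k[K])` and of the family piece `Fam = S(F′)ᵀ·C^{K′}·S(F′) − S(F)ᵀ·C^{K′}·S(F)`.  p3 g12's sectional dictionary
(`…SectorSliceSectionalRows.secRowWt_norm_pullback_sliceCT_le`) turns a FIXED-TIME weighted spatial `ℓ¹` bound of the per-pair character sum into the sectional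
row of `Sᵀ C S` for ONE family and the slice symbol; this file extends it to the two pieces:

* §1 `secRowWt_norm_pullback_normalCovariance_le` — the same dictionary for an ARBITRARY symbol `p` (single family): from
  `∀ z₁, Σ_{z₂} w(z₂)·‖Σ_q χ_{q₁}(z₁)χ_{q₂}(z₂) • (βL²)⁻² F_ω F_{ω′} p(q)‖ ≤ T` to `Σ_y ‖(S(F)ᵀ N(p) S(F)) X ((t,y),ℓ)‖·w(x⃗ − y) ≤ 2T`;
* §2 `secRowWt_norm_pullback_normalCovariance_familySub_le` — two families (pair-difference symbol `(F′_ωF′_{ω′} − F_ωF_{ω′})·p`), on k3c3-p2's entry bound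
  `norm_pullback_normalCovariance_familySub_le`;
* §3 the pieces of the tower's telescope (k3c4-p2's `hubbardCovSliceCT_sub_eq_normalCovariance`: `C^{K′} − C^{K} = N(Ψ̂[K′] − Ψ̂[K])`):
  **`secRowWt_sliceCT_covSub_bgmFat_le`** (sectional rows of `Cov(K,K′)` `≤ 2T` from fixed-time bounds for `F̃_ωF̃_{ω′}·(Ψ̂[K′] − Ψ̂[K])`) and
  **`secRowWt_sliceCT_familySub_le`** (sectional rows of `Fam` `≤ 2T` from fixed-time bounds for `(F′_ωF′_{ω′} − F_ωF_{ω′})·Ψ̂[K′]`, any two families).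

* §4 `secRowWt_sliceCT_familySub_le_of_pairBounds` (the family piece from the suppliers' TWO increment-pair bounds, `norm_charSum_pairSub_le_add`) and
  `secWt_tnorm_le_of_rateWt` (their rate-weight currency ⇒ `1 + Λ_w·tnorm`, factor `D`).

The fixed-time data `T` of the increments are the next bricks (increment symbol data: k3c3-p2 `bgmFatIncrPair_data`, k3c4-p2 slice-symbol defect jets).
Everything is proved; no definitions; nothing asserts any stub, K3, VL or superconductivity. [cite: BenfattoGiulianiMastropietro2006, §2.7 (2.66)–(2.67), §3 (3.3)]
-/

noncomputable section

namespace Summit.HubbardSuperconductivity.HubbardSuperconductivity.Theorems.TorusFourierL2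

set_option linter.dupNamespace false -- summit = problem name (single-conjunct summit), D-0017

open Finset Complex Literature.MathematicalPhysics.QuantumLattice Literature.Probability.LatticeModels
open Summit.HubbardSuperconductivity.HubbardSuperconductivity.Theorems.TwoVolumeDefect
open Summit.HubbardSuperconductivity.HubbardSuperconductivity.Theorems.TwoVolumeSource
open scoped Real

/-! ## §1 Single family, arbitrary symbol -/

section Single

variable {L M N : ℕ} [NeZero L] [NeZero M]

/-- **The sectional weighted row of `S(F)ᵀ N(p) S(F)` for an arbitrary symbol `p`**: for every nonnegative even weight `w` on the spatial torus, every
`X = (x, ((ω,σ),c))`, time slice `t` and label `ℓ = ((ω′,σ′),c′)`, if the `w`-weighted spatial `ℓ¹` norm of the per-pair character sum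
`Σ_q χ_{q₁}(z₁)χ_{q₂}(z₂) • (βL²)⁻² F_ω(q) F_{ω′}(q) p(q, σ)` is `≤ T` at EVERY time difference `z₁`, then `Σ_y ‖(S(F)ᵀ N(p) S(F)) X ((t,y),ℓ)‖·w(x⃗ − y) ≤ 2·T`
(`…SectorSliceSectionalRows.secRowWt_norm_pullback_sliceCT_le` is the case `p = Ψ̂_{(Λ,Λ′]}[K]`). [cite: BenfattoGiulianiMastropietro2006, §2.7 (2.66)–(2.67)] -/
theorem secRowWt_norm_pullback_normalCovariance_le {β : ℝ} (hβ : β ≠ 0) (F : Fin N → FreqMomentum L M → ℂ) (p : FreqMomentum L M × Fin 2 → ℂ)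
    (w : TorusSite 2 L → ℝ) (hw0 : ∀ z, 0 ≤ w z) (hw : ∀ b, w (-b) = w b)
    (X : SpaceTimeIdx L M × SectorLeg N) (t : ImagTimeIdx M) (ℓ : SectorLeg N) {T : ℝ}
    (hT : ∀ z₁ : TorusSite 1 (2 * M), ∑ z₂ : TorusSite 2 L, w z₂ *
        ‖∑ q : TorusSite 1 (2 * M) × TorusSite 2 L, (torusChar q.1 z₁ * torusChar q.2 z₂) •
          ((((1 / (β * (L : ℝ) ^ 2) : ℝ) : ℂ) ^ 2 *
            (F X.2.1.1 (⟨(q.1 0).val, ZMod.val_lt (q.1 0)⟩, q.2) * F ℓ.1.1 (⟨(q.1 0).val, ZMod.val_lt (q.1 0)⟩, q.2) *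
              p ((⟨(q.1 0).val, ZMod.val_lt (q.1 0)⟩, q.2), X.2.1.2))))‖ ≤ T) :
    ∑ y : TorusSite 2 L, ‖((sectorSubMatrix L M β F).transpose * normalCovariance L M p * sectorSubMatrix L M β F) X ((t, y), ℓ)‖ * w (X.1.2 - y) ≤
      2 * T := by
  classical
  set Tf : TorusSite 1 (2 * M) → TorusSite 2 L → ℝ := fun z₁ z₂ =>
    ‖∑ q : TorusSite 1 (2 * M) × TorusSite 2 L, (torusChar q.1 z₁ * torusChar q.2 z₂) •
      ((((1 / (β * (L : ℝ) ^ 2) : ℝ) : ℂ) ^ 2 *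
        (F X.2.1.1 (⟨(q.1 0).val, ZMod.val_lt (q.1 0)⟩, q.2) * F ℓ.1.1 (⟨(q.1 0).val, ZMod.val_lt (q.1 0)⟩, q.2) *
          p ((⟨(q.1 0).val, ZMod.val_lt (q.1 0)⟩, q.2), X.2.1.2))))‖ with hTf
  have hT' : ∀ z₁, ∑ z₂, w z₂ * Tf z₁ z₂ ≤ T := fun z₁ => hT z₁
  set zp : TorusSite 1 (2 * M) := fun _ : Fin 1 => ((X.1.1 : ℕ) : ZMod (2 * M)) - ((t : ℕ) : ZMod (2 * M)) with hzp
  set zm : TorusSite 1 (2 * M) := fun _ : Fin 1 => ((t : ℕ) : ZMod (2 * M)) - ((X.1.1 : ℕ) : ZMod (2 * M)) with hzm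
  calc ∑ y : TorusSite 2 L, ‖((sectorSubMatrix L M β F).transpose * normalCovariance L M p * sectorSubMatrix L M β F) X ((t, y), ℓ)‖ * w (X.1.2 - y)
      ≤ ∑ y : TorusSite 2 L, (Tf zp (X.1.2 - y) + Tf zm (y - X.1.2)) * w (X.1.2 - y) :=
        Finset.sum_le_sum fun y _ => mul_le_mul_of_nonneg_right (norm_pullback_normalCovariance_le hβ F p X ((t, y), ℓ)) (hw0 _)
    _ = ∑ y : TorusSite 2 L, (w (X.1.2 - y) * Tf zp (X.1.2 - y) + w (y - X.1.2) * Tf zm (y - X.1.2)) := by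
        refine Finset.sum_congr rfl fun y _ => ?_
        rw [show w (y - X.1.2) = w (X.1.2 - y) by rw [← hw (y - X.1.2), neg_sub]]
        ring
    _ = ∑ z₂ : TorusSite 2 L, w z₂ * Tf zp z₂ + ∑ z₂ : TorusSite 2 L, w z₂ * Tf zm z₂ := by
        rw [Finset.sum_add_distrib]
        congr 1
        · exact Fintype.sum_equiv (Equiv.subLeft X.1.2) _ _ fun y => rfl
        · exact Fintype.sum_equiv (Equiv.subRight X.1.2) _ _ fun y => rfl
    _ ≤ T + T := add_le_add (hT' zp) (hT' zm)
    _ = 2 * T := by ring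

end Single

/-! ## §2 Two families (the family piece) -/

section Family

variable {L M N : ℕ} [NeZero L] [NeZero M]

/-- **The sectional weighted row of the family defect `S(F′)ᵀ N(p) S(F′) − S(F)ᵀ N(p) S(F)`**: the same dictionary with the pair-difference symbol
`(F′_ωF′_{ω′} − F_ωF_{ω′})·p` (k3c3-p2's entry bound `norm_pullback_normalCovariance_familySub_le`): fixed-time weighted spatial `ℓ¹` bounds `≤ T` at every
time difference give `Σ_y ‖(…) X ((t,y),ℓ)‖·w(x⃗ − y) ≤ 2·T`. [cite: BenfattoGiulianiMastropietro2006, §2.7 (2.66)–(2.67), §3 (3.3)] -/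
theorem secRowWt_norm_pullback_normalCovariance_familySub_le {β : ℝ} (hβ : β ≠ 0) (F' F : Fin N → FreqMomentum L M → ℂ)
    (p : FreqMomentum L M × Fin 2 → ℂ) (w : TorusSite 2 L → ℝ) (hw0 : ∀ z, 0 ≤ w z) (hw : ∀ b, w (-b) = w b)
    (X : SpaceTimeIdx L M × SectorLeg N) (t : ImagTimeIdx M) (ℓ : SectorLeg N) {T : ℝ}
    (hT : ∀ z₁ : TorusSite 1 (2 * M), ∑ z₂ : TorusSite 2 L, w z₂ *
        ‖∑ q : TorusSite 1 (2 * M) × TorusSite 2 L, (torusChar q.1 z₁ * torusChar q.2 z₂) •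
          ((((1 / (β * (L : ℝ) ^ 2) : ℝ) : ℂ) ^ 2 *
            ((F' X.2.1.1 (⟨(q.1 0).val, ZMod.val_lt (q.1 0)⟩, q.2) * F' ℓ.1.1 (⟨(q.1 0).val, ZMod.val_lt (q.1 0)⟩, q.2) -
              F X.2.1.1 (⟨(q.1 0).val, ZMod.val_lt (q.1 0)⟩, q.2) * F ℓ.1.1 (⟨(q.1 0).val, ZMod.val_lt (q.1 0)⟩, q.2)) *
              p ((⟨(q.1 0).val, ZMod.val_lt (q.1 0)⟩, q.2), X.2.1.2))))‖ ≤ T) :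
    ∑ y : TorusSite 2 L,
        ‖((sectorSubMatrix L M β F').transpose * normalCovariance L M p * sectorSubMatrix L M β F' -
            (sectorSubMatrix L M β F).transpose * normalCovariance L M p * sectorSubMatrix L M β F) X ((t, y), ℓ)‖ * w (X.1.2 - y) ≤
      2 * T := by
  classical
  set Tf : TorusSite 1 (2 * M) → TorusSite 2 L → ℝ := fun z₁ z₂ =>
    ‖∑ q : TorusSite 1 (2 * M) × TorusSite 2 L, (torusChar q.1 z₁ * torusChar q.2 z₂) •
      ((((1 / (β * (L : ℝ) ^ 2) : ℝ) : ℂ) ^ 2 *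
        ((F' X.2.1.1 (⟨(q.1 0).val, ZMod.val_lt (q.1 0)⟩, q.2) * F' ℓ.1.1 (⟨(q.1 0).val, ZMod.val_lt (q.1 0)⟩, q.2) -
          F X.2.1.1 (⟨(q.1 0).val, ZMod.val_lt (q.1 0)⟩, q.2) * F ℓ.1.1 (⟨(q.1 0).val, ZMod.val_lt (q.1 0)⟩, q.2)) *
          p ((⟨(q.1 0).val, ZMod.val_lt (q.1 0)⟩, q.2), X.2.1.2))))‖ with hTf
  have hT' : ∀ z₁, ∑ z₂, w z₂ * Tf z₁ z₂ ≤ T := fun z₁ => hT z₁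
  set zp : TorusSite 1 (2 * M) := fun _ : Fin 1 => ((X.1.1 : ℕ) : ZMod (2 * M)) - ((t : ℕ) : ZMod (2 * M)) with hzp
  set zm : TorusSite 1 (2 * M) := fun _ : Fin 1 => ((t : ℕ) : ZMod (2 * M)) - ((X.1.1 : ℕ) : ZMod (2 * M)) with hzm
  calc ∑ y : TorusSite 2 L,
        ‖((sectorSubMatrix L M β F').transpose * normalCovariance L M p * sectorSubMatrix L M β F' -
            (sectorSubMatrix L M β F).transpose * normalCovariance L M p * sectorSubMatrix L M β F) X ((t, y), ℓ)‖ * w (X.1.2 - y)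
      ≤ ∑ y : TorusSite 2 L, (Tf zp (X.1.2 - y) + Tf zm (y - X.1.2)) * w (X.1.2 - y) :=
        Finset.sum_le_sum fun y _ =>
          mul_le_mul_of_nonneg_right (norm_pullback_normalCovariance_familySub_le hβ F' F p X ((t, y), ℓ)) (hw0 _)
    _ = ∑ y : TorusSite 2 L, (w (X.1.2 - y) * Tf zp (X.1.2 - y) + w (y - X.1.2) * Tf zm (y - X.1.2)) := by
        refine Finset.sum_congr rfl fun y _ => ?_
        rw [show w (y - X.1.2) = w (X.1.2 - y) by rw [← hw (y - X.1.2), neg_sub]]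
        ring
    _ = ∑ z₂ : TorusSite 2 L, w z₂ * Tf zp z₂ + ∑ z₂ : TorusSite 2 L, w z₂ * Tf zm z₂ := by
        rw [Finset.sum_add_distrib]
        congr 1
        · exact Fintype.sum_equiv (Equiv.subLeft X.1.2) _ _ fun y => rfl
        · exact Fintype.sum_equiv (Equiv.subRight X.1.2) _ _ fun y => rfl
    _ ≤ T + T := add_le_add (hT' zp) (hT' zm)
    _ = 2 * T := by ring

end Family

/-! ## §3 The telescope pieces of the tower -/

section Tower

variable {L M N : ℕ} [NeZero L] [NeZero M]

/-- The `(1 + Λ_w·tnorm)` site weight is even. [folklore] -/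
theorem one_add_mul_tnorm_neg (Λw : ℝ) (b : TorusSite 2 L) : 1 + Λw * (Torus.tnorm (-b) : ℝ) = 1 + Λw * (Torus.tnorm b : ℝ) := by
  rw [le_antisymm (Torus.tnorm_neg_le b) (by simpa using Torus.tnorm_neg_le (-b))]

/-- **Sectional rows of the COVARIANCE piece `Cov(K,K′) = S(F)ᵀ·(C^{K′}_{(Λ,Λ′]} − C^{K}_{(Λ,Λ′]})·S(F)`** (any family `F`; the telescope takes
`F = F̃_k[K]`): from fixed-time `(1 + Λ_w·tnorm)`-weighted spatial `ℓ¹` bounds `≤ T` of the per-pair character sums of `(βL²)⁻² F_ω F_{ω′}·(Ψ̂[K′] − Ψ̂[K])`,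
`Σ_y ‖Cov X ((t,y),ℓ)‖·(1 + Λ_w·tnorm(x⃗ − y)) ≤ 2·T` (`0 ≤ Λ_w`). [cite: BenfattoGiulianiMastropietro2006, §2.7 (2.66)–(2.67), §3 (3.3)] -/
theorem secRowWt_sliceCT_covSub_le {β : ℝ} (hβ : β ≠ 0) (μ : ℝ) (K K' : TrigPolyC4v) (Λ Λ' : ℝ) (F : Fin N → FreqMomentum L M → ℂ) {Λw : ℝ}
    (hΛw : 0 ≤ Λw) (X : SpaceTimeIdx L M × SectorLeg N) (t : ImagTimeIdx M) (ℓ : SectorLeg N) {T : ℝ}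
    (hT : ∀ z₁ : TorusSite 1 (2 * M), ∑ z₂ : TorusSite 2 L, (1 + Λw * (Torus.tnorm z₂ : ℝ)) *
        ‖∑ q : TorusSite 1 (2 * M) × TorusSite 2 L, (torusChar q.1 z₁ * torusChar q.2 z₂) •
          ((((1 / (β * (L : ℝ) ^ 2) : ℝ) : ℂ) ^ 2 *
            (F X.2.1.1 (⟨(q.1 0).val, ZMod.val_lt (q.1 0)⟩, q.2) * F ℓ.1.1 (⟨(q.1 0).val, ZMod.val_lt (q.1 0)⟩, q.2) *
              (sliceSymbolFnXi (β * (L : ℝ) ^ 2) 0 Λ Λ' (matsubaraFreq β M ⟨(q.1 0).val, ZMod.val_lt (q.1 0)⟩) (nambuXiCT L μ K' q.2) -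
                sliceSymbolFnXi (β * (L : ℝ) ^ 2) 0 Λ Λ' (matsubaraFreq β M ⟨(q.1 0).val, ZMod.val_lt (q.1 0)⟩) (nambuXiCT L μ K q.2)))))‖ ≤ T) :
    ∑ y : TorusSite 2 L,
        ‖((sectorSubMatrix L M β F).transpose * (hubbardCovSliceCT L M β μ 0 K' Λ Λ' - hubbardCovSliceCT L M β μ 0 K Λ Λ') *
            sectorSubMatrix L M β F) X ((t, y), ℓ)‖ * (1 + Λw * (Torus.tnorm (X.1.2 - y) : ℝ)) ≤ 2 * T := by
  rw [hubbardCovSliceCT_sub_eq_normalCovariance hβ μ K K' Λ Λ']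
  exact secRowWt_norm_pullback_normalCovariance_le hβ F _ (fun z : TorusSite 2 L => 1 + Λw * (Torus.tnorm z : ℝ)) (fun z => by positivity)
    (one_add_mul_tnorm_neg Λw) X t ℓ hT

/-- **Sectional rows of the FAMILY piece `Fam = S(F′)ᵀ·C^{K}_{(Λ,Λ′]}·S(F′) − S(F)ᵀ·C^{K}_{(Λ,Λ′]}·S(F)`** (any two families; the telescope takes
`F′ = F̃_k[K_i]`, `F = F̃_k[K_{i+1}]`, covariance frame `K := K_{i+1}` — p597679's left-hand side at `(K, K′) := (K_{i+1}, K_i)`): from fixed-time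
`(1 + Λ_w·tnorm)`-weighted spatial `ℓ¹` bounds `≤ T` of the per-pair character sums of `(βL²)⁻²(F′_ωF′_{ω′} − F_ωF_{ω′})·Ψ̂[K]`,
`Σ_y ‖Fam X ((t,y),ℓ)‖·(1 + Λ_w·tnorm(x⃗ − y)) ≤ 2·T`. [cite: BenfattoGiulianiMastropietro2006, §2.7 (2.66)–(2.67), §3 (3.3)] -/
theorem secRowWt_sliceCT_familySub_le {β : ℝ} (hβ : β ≠ 0) (μ : ℝ) (K : TrigPolyC4v) (Λ Λ' : ℝ) (F' F : Fin N → FreqMomentum L M → ℂ) {Λw : ℝ}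
    (hΛw : 0 ≤ Λw) (X : SpaceTimeIdx L M × SectorLeg N) (t : ImagTimeIdx M) (ℓ : SectorLeg N) {T : ℝ}
    (hT : ∀ z₁ : TorusSite 1 (2 * M), ∑ z₂ : TorusSite 2 L, (1 + Λw * (Torus.tnorm z₂ : ℝ)) *
        ‖∑ q : TorusSite 1 (2 * M) × TorusSite 2 L, (torusChar q.1 z₁ * torusChar q.2 z₂) •
          ((((1 / (β * (L : ℝ) ^ 2) : ℝ) : ℂ) ^ 2 *
            ((F' X.2.1.1 (⟨(q.1 0).val, ZMod.val_lt (q.1 0)⟩, q.2) * F' ℓ.1.1 (⟨(q.1 0).val, ZMod.val_lt (q.1 0)⟩, q.2) -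
              F X.2.1.1 (⟨(q.1 0).val, ZMod.val_lt (q.1 0)⟩, q.2) * F ℓ.1.1 (⟨(q.1 0).val, ZMod.val_lt (q.1 0)⟩, q.2)) *
              sliceSymbolFnXi (β * (L : ℝ) ^ 2) 0 Λ Λ' (matsubaraFreq β M ⟨(q.1 0).val, ZMod.val_lt (q.1 0)⟩) (nambuXiCT L μ K q.2))))‖ ≤ T) :
    ∑ y : TorusSite 2 L,
        ‖((sectorSubMatrix L M β F').transpose * hubbardCovSliceCT L M β μ 0 K Λ Λ' * sectorSubMatrix L M β F' -
            (sectorSubMatrix L M β F).transpose * hubbardCovSliceCT L M β μ 0 K Λ Λ' * sectorSubMatrix L M β F) X ((t, y), ℓ)‖ *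
          (1 + Λw * (Torus.tnorm (X.1.2 - y) : ℝ)) ≤ 2 * T := by
  rw [hubbardCovSliceCT_eq_normalCovariance_sliceSymbolFnXi hβ μ K Λ Λ']
  exact secRowWt_norm_pullback_normalCovariance_familySub_le hβ F' F _ (fun z : TorusSite 2 L => 1 + Λw * (Torus.tnorm z : ℝ))
    (fun z => by positivity) (one_add_mul_tnorm_neg Λw) X t ℓ hT

end Tower

/-! ## §4 The family piece from the suppliers' TWO increment-pair bounds; the rate-weight currency -/

section Split

variable {L M N : ℕ} [NeZero L] [NeZero M]

/-- **The pair-difference character sum splits into the two increment-pair character sums** (pointwise in `(z₁, z₂)`):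
`(F′_ωF′_{ω′} − F_ωF_{ω′})·p = (F′_ω − F_ω)·F′_{ω′}·p + (F′_{ω′} − F_{ω′})·F_ω·p` — the suppliers' bricks bound ONE increment pair
`(F′ − F)_{ω₁}·G_{ω₂}` at a time (k3c3-p2 `slicePairWt_bgmFatIncr_le`). [folklore] -/
theorem norm_charSum_pairSub_le_add (c : ℂ) (F' F : Fin N → FreqMomentum L M → ℂ) (p : FreqMomentum L M × Fin 2 → ℂ) (ω ω' : Fin N) (σ : Fin 2)
    (z₁ : TorusSite 1 (2 * M)) (z₂ : TorusSite 2 L) :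
    ‖∑ q : TorusSite 1 (2 * M) × TorusSite 2 L, (torusChar q.1 z₁ * torusChar q.2 z₂) •
        (c * ((F' ω (⟨(q.1 0).val, ZMod.val_lt (q.1 0)⟩, q.2) * F' ω' (⟨(q.1 0).val, ZMod.val_lt (q.1 0)⟩, q.2) - F ω (⟨(q.1 0).val, ZMod.val_lt (q.1 0)⟩, q.2) * F ω' (⟨(q.1 0).val, ZMod.val_lt (q.1 0)⟩, q.2)) * p ((⟨(q.1 0).val, ZMod.val_lt (q.1 0)⟩, q.2), σ)))‖ ≤
      ‖∑ q : TorusSite 1 (2 * M) × TorusSite 2 L, (torusChar q.1 z₁ * torusChar q.2 z₂) •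
          (c * ((F' ω (⟨(q.1 0).val, ZMod.val_lt (q.1 0)⟩, q.2) - F ω (⟨(q.1 0).val, ZMod.val_lt (q.1 0)⟩, q.2)) * F' ω' (⟨(q.1 0).val, ZMod.val_lt (q.1 0)⟩, q.2) * p ((⟨(q.1 0).val, ZMod.val_lt (q.1 0)⟩, q.2), σ)))‖ +
      ‖∑ q : TorusSite 1 (2 * M) × TorusSite 2 L, (torusChar q.1 z₁ * torusChar q.2 z₂) •
          (c * ((F' ω' (⟨(q.1 0).val, ZMod.val_lt (q.1 0)⟩, q.2) - F ω' (⟨(q.1 0).val, ZMod.val_lt (q.1 0)⟩, q.2)) * F ω (⟨(q.1 0).val, ZMod.val_lt (q.1 0)⟩, q.2) * p ((⟨(q.1 0).val, ZMod.val_lt (q.1 0)⟩, q.2), σ)))‖ := by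
  refine le_trans (le_of_eq ?_) (norm_add_le _ _)
  rw [← Finset.sum_add_distrib]
  congr 1
  refine Finset.sum_congr rfl fun q _ => ?_
  rw [← smul_add]
  congr 1
  ring

/-- **Sectional rows of the family piece from the two increment-pair fixed-time bounds**: `Σ_y ‖(S(F′)ᵀC^KS(F′) − S(F)ᵀC^KS(F)) X ((t,y),ℓ)‖·(1 + Λ_w·tnorm)
≤ 2·(T₁ + T₂)` from fixed-time `(1 + Λ_w·tnorm)`-weighted spatial `ℓ¹` bounds `≤ T₁` for the increment pair `(F′ − F)_{ω_X}·F′_{ω_ℓ}·Ψ̂[K]` and `≤ T₂` for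
`(F′ − F)_{ω_ℓ}·F_{ω_X}·Ψ̂[K]`. [cite: BenfattoGiulianiMastropietro2006, §2.7 (2.66)–(2.67), §3 (3.3)] -/
theorem secRowWt_sliceCT_familySub_le_of_pairBounds {β : ℝ} (hβ : β ≠ 0) (μ : ℝ) (K : TrigPolyC4v) (Λ Λ' : ℝ) (F' F : Fin N → FreqMomentum L M → ℂ)
    {Λw : ℝ} (hΛw : 0 ≤ Λw) (X : SpaceTimeIdx L M × SectorLeg N) (t : ImagTimeIdx M) (ℓ : SectorLeg N) {T₁ T₂ : ℝ}
    (hT₁ : ∀ z₁ : TorusSite 1 (2 * M), ∑ z₂ : TorusSite 2 L, (1 + Λw * (Torus.tnorm z₂ : ℝ)) *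
        ‖∑ q : TorusSite 1 (2 * M) × TorusSite 2 L, (torusChar q.1 z₁ * torusChar q.2 z₂) •
          ((((1 / (β * (L : ℝ) ^ 2) : ℝ) : ℂ) ^ 2 *
            ((F' X.2.1.1 (⟨(q.1 0).val, ZMod.val_lt (q.1 0)⟩, q.2) - F X.2.1.1 (⟨(q.1 0).val, ZMod.val_lt (q.1 0)⟩, q.2)) * F' ℓ.1.1 (⟨(q.1 0).val, ZMod.val_lt (q.1 0)⟩, q.2) *
              sliceSymbolFnXi (β * (L : ℝ) ^ 2) 0 Λ Λ' (matsubaraFreq β M ⟨(q.1 0).val, ZMod.val_lt (q.1 0)⟩) (nambuXiCT L μ K q.2))))‖ ≤ T₁)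
    (hT₂ : ∀ z₁ : TorusSite 1 (2 * M), ∑ z₂ : TorusSite 2 L, (1 + Λw * (Torus.tnorm z₂ : ℝ)) *
        ‖∑ q : TorusSite 1 (2 * M) × TorusSite 2 L, (torusChar q.1 z₁ * torusChar q.2 z₂) •
          ((((1 / (β * (L : ℝ) ^ 2) : ℝ) : ℂ) ^ 2 *
            ((F' ℓ.1.1 (⟨(q.1 0).val, ZMod.val_lt (q.1 0)⟩, q.2) - F ℓ.1.1 (⟨(q.1 0).val, ZMod.val_lt (q.1 0)⟩, q.2)) * F X.2.1.1 (⟨(q.1 0).val, ZMod.val_lt (q.1 0)⟩, q.2) *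
              sliceSymbolFnXi (β * (L : ℝ) ^ 2) 0 Λ Λ' (matsubaraFreq β M ⟨(q.1 0).val, ZMod.val_lt (q.1 0)⟩) (nambuXiCT L μ K q.2))))‖ ≤ T₂) :
    ∑ y : TorusSite 2 L,
        ‖((sectorSubMatrix L M β F').transpose * hubbardCovSliceCT L M β μ 0 K Λ Λ' * sectorSubMatrix L M β F' -
            (sectorSubMatrix L M β F).transpose * hubbardCovSliceCT L M β μ 0 K Λ Λ' * sectorSubMatrix L M β F) X ((t, y), ℓ)‖ *
          (1 + Λw * (Torus.tnorm (X.1.2 - y) : ℝ)) ≤ 2 * (T₁ + T₂) := by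
  refine secRowWt_sliceCT_familySub_le hβ μ K Λ Λ' F' F hΛw X t ℓ fun z₁ => ?_
  calc ∑ z₂ : TorusSite 2 L, (1 + Λw * (Torus.tnorm z₂ : ℝ)) *
        ‖∑ q : TorusSite 1 (2 * M) × TorusSite 2 L, (torusChar q.1 z₁ * torusChar q.2 z₂) •
          ((((1 / (β * (L : ℝ) ^ 2) : ℝ) : ℂ) ^ 2 *
            ((F' X.2.1.1 (⟨(q.1 0).val, ZMod.val_lt (q.1 0)⟩, q.2) * F' ℓ.1.1 (⟨(q.1 0).val, ZMod.val_lt (q.1 0)⟩, q.2) - F X.2.1.1 (⟨(q.1 0).val, ZMod.val_lt (q.1 0)⟩, q.2) * F ℓ.1.1 (⟨(q.1 0).val, ZMod.val_lt (q.1 0)⟩, q.2)) *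
              sliceSymbolFnXi (β * (L : ℝ) ^ 2) 0 Λ Λ' (matsubaraFreq β M ⟨(q.1 0).val, ZMod.val_lt (q.1 0)⟩) (nambuXiCT L μ K q.2))))‖
      ≤ ∑ z₂ : TorusSite 2 L, ((1 + Λw * (Torus.tnorm z₂ : ℝ)) *
          ‖∑ q : TorusSite 1 (2 * M) × TorusSite 2 L, (torusChar q.1 z₁ * torusChar q.2 z₂) •
            ((((1 / (β * (L : ℝ) ^ 2) : ℝ) : ℂ) ^ 2 *
              ((F' X.2.1.1 (⟨(q.1 0).val, ZMod.val_lt (q.1 0)⟩, q.2) - F X.2.1.1 (⟨(q.1 0).val, ZMod.val_lt (q.1 0)⟩, q.2)) * F' ℓ.1.1 (⟨(q.1 0).val, ZMod.val_lt (q.1 0)⟩, q.2) *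
                sliceSymbolFnXi (β * (L : ℝ) ^ 2) 0 Λ Λ' (matsubaraFreq β M ⟨(q.1 0).val, ZMod.val_lt (q.1 0)⟩) (nambuXiCT L μ K q.2))))‖ +
          (1 + Λw * (Torus.tnorm z₂ : ℝ)) *
          ‖∑ q : TorusSite 1 (2 * M) × TorusSite 2 L, (torusChar q.1 z₁ * torusChar q.2 z₂) •
            ((((1 / (β * (L : ℝ) ^ 2) : ℝ) : ℂ) ^ 2 *
              ((F' ℓ.1.1 (⟨(q.1 0).val, ZMod.val_lt (q.1 0)⟩, q.2) - F ℓ.1.1 (⟨(q.1 0).val, ZMod.val_lt (q.1 0)⟩, q.2)) * F X.2.1.1 (⟨(q.1 0).val, ZMod.val_lt (q.1 0)⟩, q.2) *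
                sliceSymbolFnXi (β * (L : ℝ) ^ 2) 0 Λ Λ' (matsubaraFreq β M ⟨(q.1 0).val, ZMod.val_lt (q.1 0)⟩) (nambuXiCT L μ K q.2))))‖) := by
        refine Finset.sum_le_sum fun z₂ _ => ?_
        rw [← mul_add]
        exact mul_le_mul_of_nonneg_left (norm_charSum_pairSub_le_add ((((1 / (β * (L : ℝ) ^ 2) : ℝ) : ℂ)) ^ 2) F' F
          (fun ks => sliceSymbolFnXi (β * (L : ℝ) ^ 2) 0 Λ Λ' (matsubaraFreq β M ks.1.1) (nambuXiCT L μ K ks.1.2)) X.2.1.1 ℓ.1.1 X.2.1.2 z₁ z₂)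
          (by positivity)
    _ ≤ T₁ + T₂ := by rw [Finset.sum_add_distrib]; exact add_le_add (hT₁ z₁) (hT₂ z₁)

/-- **Rate-weight currency** (the suppliers' spatial weight `1 + s₁|z̃₂,₁| + s₁|z̃₂,₂|`): a fixed-time bound in the rate weight gives the
`(1 + Λ_w·tnorm)`-weighted one up to the factor `D` for `0 ≤ Λ_w ≤ D·s₁`, `1 ≤ D` (p3 g12 `one_add_mul_tnorm_le_mul_rateWt`). [folklore] -/
theorem secWt_tnorm_le_of_rateWt {s₁ Λw D : ℝ} (hD : 1 ≤ D) (hΛw : 0 ≤ Λw) (hd₁ : Λw ≤ D * s₁) (g : TorusSite 2 L → ℝ) (hg : ∀ z, 0 ≤ g z)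
    {T : ℝ} (h : ∑ z₂ : TorusSite 2 L, (1 + s₁ * |(((z₂ 0).valMinAbs : ℤ) : ℝ)| + s₁ * |(((z₂ 1).valMinAbs : ℤ) : ℝ)|) * g z₂ ≤ T) :
    ∑ z₂ : TorusSite 2 L, (1 + Λw * (Torus.tnorm z₂ : ℝ)) * g z₂ ≤ D * T := by
  calc ∑ z₂ : TorusSite 2 L, (1 + Λw * (Torus.tnorm z₂ : ℝ)) * g z₂
      ≤ ∑ z₂ : TorusSite 2 L, D * ((1 + s₁ * |(((z₂ 0).valMinAbs : ℤ) : ℝ)| + s₁ * |(((z₂ 1).valMinAbs : ℤ) : ℝ)|) * g z₂) :=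
        Finset.sum_le_sum fun z₂ _ => by
          rw [← mul_assoc]; exact mul_le_mul_of_nonneg_right (one_add_mul_tnorm_le_mul_rateWt hD hΛw hd₁ z₂) (hg z₂)
    _ = D * ∑ z₂ : TorusSite 2 L, (1 + s₁ * |(((z₂ 0).valMinAbs : ℤ) : ℝ)| + s₁ * |(((z₂ 1).valMinAbs : ℤ) : ℝ)|) * g z₂ := by
        rw [Finset.mul_sum]
    _ ≤ D * T := mul_le_mul_of_nonneg_left h (zero_le_one.trans hD)

end Split

end Summit.HubbardSuperconductivity.HubbardSuperconductivity.Theorems.TorusFourierL2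

end
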